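import Summits.NavierStokesRegularity.NavierStokesRegularity.Theses.HodographBetchov
import Literature.Analysis.FluidPDE.NSVorticityBoundedTopQuant
import Literature.Analysis.FluidPDE.ClassicalSuitable
import Literature.Analysis.FluidPDE.ClassicalSolutionRescale
import Literature.Analysis.FluidPDE.NSViscosityRescaling
import Literature.Analysis.FluidPDE.TaoEnstrophyLocalisation
import Literature.Analysis.FluidPDE.SpaceTimeCalculus
import Literature.Analysis.FluidPDE.SpaceTimeCalculusC1

/-!
# `SlowClassProduction` (stmt-NavierStokesRegularity-15831), line `birth` — the deep-slow
# vorticity bound (helper for stub 2 `stub_deepSlowProduction`)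

Route `HodographBetchov`, crux 2, registered skeleton `Cruxes/SlowClassProduction/Lines/birth.lean`.
Stub 2 asks for a uniform budget of the enstrophy production `P = ⟪ω, ∇u ω⟫` on the DEEP piece
of the slow class: points `(s, x)` with `|u| ≤ l` on the whole backward parabolic cylinder
`[s − r²/ν, s] × B̄(x, r)`.  This file supplies its a-priori core, with every analytic input a
theorem of the tree:

**at every such point the vorticity is bounded, `‖curl u(s, x)‖ ≤ K`, by a constant depending
only on `ν, l, r` and the total dissipation `∫₀ᵀ∫ |∇u|²_F`** (`norm_curl_le_of_slow_cylinder`).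

Proof.  Normalise the viscosity and move `(s, x)` to the origin,
`w(σ, y) = ν⁻¹ u(s + σ/ν, x + y)` (`IsClassicalNSSolutionOn.stRescale`): `w` is a classical, hence
distributional, solution with `ν = 1` on the centred cylinder `Q*_R((−R², 0)) = ]−2R², 0[ × B(0, R)`,
`R = r/2`, bounded there by `M = l/ν`, with the classical gradient as weak spatial gradient and
`∫∫_{Q*} |∇w|²_F ≤ ν⁻¹ ∫₀ᵀ∫ |∇u|²_F` (change of variables `setLIntegral_preimage_comp_stAffine`).
Serrin's pressure-free interior theory in the quantitative form of the tree
(`SerrinTopQuant.spin_bound_top_quant`: Robinson–Rodrigo–Sadowski 2016, Thm. 13.7, Steps 1–2 with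
constants fixed before the solution) bounds the spin entries `∂ⱼwᵢ − ∂ᵢwⱼ` a.e. on an inner
cylinder reaching the top time; by continuity of `∇w` up to the top (the solution is classical on
`[0,T)`, `s < T`) the bound holds at the top centre `(0, 0)`, i.e. for `ν⁻¹ ∇u(s, x)`, and the three
components of `curl u(s, x)` are such entries.
-/

noncomputable section

-- the summit and its single problem share the name `NavierStokesRegularity` (D-0017 nested layout)
set_option linter.dupNamespace false

namespace Summit.NavierStokesRegularity.NavierStokesRegularity.Theorems.SlowClassProduction.Birth

open Set MeasureTheory Function Metric Filter Topology Literature.Analysis.FluidPDE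
open scoped ENNReal NNReal

/-- An a.e. bound `f ≤ K` on an open space–time set for a function continuous there holds at
every point of the set (open sets have positive Lebesgue measure). [folklore] -/
theorem forall_le_of_ae_restrict_le {O : Set (ℝ × EuclideanSpace ℝ (Fin 3))} (hO : IsOpen O)
    {f : ℝ × EuclideanSpace ℝ (Fin 3) → ℝ} {K : ℝ} (hf : ContinuousOn f O)
    (h : ∀ᵐ z ∂(volume.restrict O), f z ≤ K) : ∀ z ∈ O, f z ≤ K := by
  have hopen : IsOpen (O ∩ f ⁻¹' Ioi K) := hf.isOpen_inter_preimage hO isOpen_Ioi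
  have hnull : volume (O ∩ f ⁻¹' Ioi K) = 0 := by
    rw [ae_iff, Measure.restrict_apply' hO.measurableSet] at h
    simp only [not_le] at h
    rw [inter_comm]
    exact h
  have hempty := (hopen.measure_eq_zero_iff volume).1 hnull
  intro z hz
  by_contra hlt
  have hmem : z ∈ O ∩ f ⁻¹' Ioi K := ⟨hz, not_le.1 hlt⟩
  rw [hempty] at hmem
  exact hmem

/-- A vector of `ℝ³` whose three coordinates are bounded by `a ≥ 0` in absolute value has norm at
most `2a` (`√3 ≤ 2`). [folklore] -/
theorem norm_le_two_mul_of_abs_apply_le {v : EuclideanSpace ℝ (Fin 3)} {a : ℝ} (ha : 0 ≤ a)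
    (h : ∀ i, |v i| ≤ a) : ‖v‖ ≤ 2 * a := by
  have hc : ∀ i : Fin 3, ‖v i‖ ^ 2 ≤ a ^ 2 := fun i => by
    rw [Real.norm_eq_abs]
    exact pow_le_pow_left₀ (abs_nonneg _) (h i) 2
  rw [EuclideanSpace.norm_eq, Real.sqrt_le_iff]
  refine ⟨by positivity, ?_⟩
  calc ∑ i, ‖v i‖ ^ 2 ≤ ∑ _i : Fin 3, a ^ 2 := Finset.sum_le_sum fun i _ => hc i
    _ = 3 * a ^ 2 := by simp
    _ ≤ (2 * a) ^ 2 := by nlinarith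

/-- The coordinates of `curl v (x)` are spin entries `∂ⱼvᵢ − ∂ᵢvⱼ` of the Jacobian; a bound on all
spin entries bounds them. [folklore] -/
theorem abs_curl_apply_le_of_spin {v : EuclideanSpace ℝ (Fin 3) → EuclideanSpace ℝ (Fin 3)}
    {x : EuclideanSpace ℝ (Fin 3)} {a : ℝ}
    (h : ∀ i j : Fin 3, |fderiv ℝ v x (EuclideanSpace.single j 1) i -
      fderiv ℝ v x (EuclideanSpace.single i 1) j| ≤ a) :
    ∀ k : Fin 3, |curl v x k| ≤ a := by
  intro k
  fin_cases k
  · simpa [curl] using h 2 1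
  · simpa [curl] using h 0 2
  · simpa [curl] using h 1 0

/-- **Vorticity bound at points with a slow backward cylinder** (the a-priori core of
`stub_deepSlowProduction`).  Let `(u, p)` be a classical solution of the unforced Navier–Stokes
system on `ℝ³ × [0, T)` with viscosity `ν > 0` and finite total dissipation
`∫₀ᵀ∫ |∇u|²_F < ∞`, and let `r > 0`, `l ∈ ℝ`.  There is `K` such that at every `(s, x₀)` with
`r²/ν ≤ s < T` and `‖u‖ ≤ l` on `[s − r²/ν, s] × B̄(x₀, r)` one has `‖curl u(s, x₀)‖ ≤ K`.
Proof: viscosity normalisation and translation (`IsClassicalNSSolutionOn.stRescale`), classical ⇒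
distributional with the classical gradient as weak spatial gradient
(`isDistributionalNSSolutionOn_of_contDiffOn`, `hasWeakSpatialGradientOn_of_contDiffOn`), the
dissipation of the rescaled field on the cylinder by change of variables, Serrin's quantitative
spin bound up to the top (`SerrinTopQuant.spin_bound_top_quant`, Robinson–Rodrigo–Sadowski 2016,
Thm. 13.7 Steps 1–2), and continuity of `∇u` up to the top time `s < T`.
[cite: RobinsonRodrigoSadowskiCUP2016, Thm. 13.7, proof §13.3.2 Steps 1–2] -/
theorem norm_curl_le_of_slow_cylinder :
    ∀ (ν T : ℝ), 0 < ν →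
      ∀ (u : ℝ → EuclideanSpace ℝ (Fin 3) → EuclideanSpace ℝ (Fin 3))
        (p : ℝ → EuclideanSpace ℝ (Fin 3) → ℝ),
        Literature.Analysis.FluidPDE.IsClassicalNSSolutionOn (Set.Ico 0 T) ν 0 u p →
        (∫⁻ τ in Set.Ioo 0 T, ∫⁻ x, ENNReal.ofReal
          (Literature.Analysis.FluidPDE.frobeniusNormSq (fderiv ℝ (u τ) x))) ≠ ⊤ →
        ∀ (l r : ℝ), 0 < r → ∃ K : ℝ, ∀ s : ℝ, r ^ 2 / ν ≤ s → s < T →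
          ∀ x₀ : EuclideanSpace ℝ (Fin 3),
            (∀ σ ∈ Set.Icc (s - r ^ 2 / ν) s, ∀ y ∈ Metric.closedBall x₀ r, ‖u σ y‖ ≤ l) →
            ‖Literature.Analysis.FluidPDE.curl (u s) x₀‖ ≤ K := by
  intro ν T hν u p hcl hD l r hr
  -- ### constants, fixed before the point
  set D : ℝ≥0∞ := ∫⁻ τ in Ioo 0 T, ∫⁻ x, ENNReal.ofReal (frobeniusNormSq (fderiv ℝ (u τ) x))
    with hD_def
  set R : ℝ := r / 2 with hR_def
  set ρ : ℝ := r / 4 with hρ_def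
  have hR0 : 0 < R := by positivity
  have hρ0 : 0 < ρ := by positivity
  have hρR : ρ < R := by rw [hR_def, hρ_def]; linarith
  set β : ℝ := ν⁻¹ with hβ_def
  have hβ0 : 0 < β := by positivity
  set M : ℝ := β * l with hM_def
  set B : ℝ≥0 := (ENNReal.ofReal β * D).toNNReal with hB_def
  have hBtop : ENNReal.ofReal β * D ≠ ⊤ := ENNReal.mul_ne_top ENNReal.ofReal_ne_top hD
  obtain ⟨K, hK0, hK⟩ := SerrinTopQuant.spin_bound_top_quant hρ0 hρR M B
  refine ⟨2 * (ν * K), fun s hs hsT x₀ hslow => ?_⟩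
  -- ### elementary geometry of the cylinder
  have hr2 : 0 < r ^ 2 / ν := by positivity
  have hs0 : 0 < s := hr2.trans_le hs
  have hT : 0 < T := hs0.trans hsT
  have h2R : 2 * R ^ 2 = r ^ 2 / 2 := by rw [hR_def]; ring
  have hβr : β * (r ^ 2 / 2) ≤ s / 2 := by
    rw [hβ_def]
    have : ν⁻¹ * (r ^ 2 / 2) = (r ^ 2 / ν) / 2 := by field_simp
    rw [this]
    linarith
  -- time of the original solution attached to a rescaled time `σ`
  have htime : ∀ σ : ℝ, -(2 * R ^ 2) ≤ σ → σ ≤ 0 →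
      s + β * σ ∈ Ioo 0 T ∧ s + β * σ ∈ Icc (s - r ^ 2 / ν) s := by
    intro σ hσ1 hσ2
    have h1 : -(β * (r ^ 2 / 2)) ≤ β * σ := by
      rw [h2R] at hσ1
      nlinarith
    have h2 : β * σ ≤ 0 := mul_nonpos_of_nonneg_of_nonpos hβ0.le hσ2
    have h3 : r ^ 2 / ν = β * r ^ 2 := by rw [hβ_def]; field_simp
    refine ⟨⟨by linarith, by linarith⟩, ?_, by linarith⟩
    rw [h3]
    nlinarith [sq_nonneg r]
  -- ### the rescaled, translated solution `w(σ, y) = ν⁻¹ u(s + σ/ν, x₀ + y)` with `ν = 1`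
  have hclo : IsClassicalNSSolutionOn (Ioo 0 T) ν 0 u p :=
    hcl.mono Ioo_subset_Ico_self isOpen_Ioo.uniqueDiffOn
  set S₀ : Set ℝ := (fun σ => s + β * σ) ⁻¹' Ioo 0 T with hS₀_def
  set w : ℝ → EuclideanSpace ℝ (Fin 3) → EuclideanSpace ℝ (Fin 3) := β • stPull β 1 s x₀ u
    with hw_def
  set q : ℝ → EuclideanSpace ℝ (Fin 3) → ℝ := β ^ 2 • stPull β 1 s x₀ p with hq_def
  have hw : IsClassicalNSSolutionOn S₀ 1 0 w q := by
    have h := hclo.stRescale (α := β) (β := β) (γ := 1) hβ0 one_pos (mul_one β).symm s x₀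
    have hv : β * ν / 1 = 1 := by rw [hβ_def, div_one, inv_mul_cancel₀ hν.ne']
    rwa [smul_stPull_zero, hv] at h
  have hS₀ : IsOpen S₀ := isOpen_Ioo.preimage (continuous_const.add (continuous_const.mul continuous_id))
  have hmemS₀ : ∀ σ : ℝ, -(2 * R ^ 2) ≤ σ → σ ≤ 0 → σ ∈ S₀ := fun σ h1 h2 => (htime σ h1 h2).1
  -- the centred cylinder `Q*_R((-R², 0))` and the closed box containing the inner one
  set c : ℝ × EuclideanSpace ℝ (Fin 3) := ((-R ^ 2 : ℝ), (0 : EuclideanSpace ℝ (Fin 3))) with hc_def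
  have hcyl_time : ∀ z ∈ parabolicCylinderCentered R c, -(2 * R ^ 2) ≤ z.1 ∧ z.1 ≤ 0 := by
    intro z hz
    rw [mem_parabolicCylinderCentered] at hz
    obtain ⟨⟨h1, h2⟩, -⟩ := hz
    change -R ^ 2 - R ^ 2 < z.1 at h1
    change z.1 < -R ^ 2 + R ^ 2 at h2
    constructor <;> linarith
  have hcyl_sub : parabolicCylinderCentered R c ⊆ S₀ ×ˢ (univ : Set (EuclideanSpace ℝ (Fin 3))) :=
    fun z hz => mk_mem_prod (hmemS₀ z.1 (hcyl_time z hz).1 (hcyl_time z hz).2) (mem_univ _)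
  have hcyl_meas : MeasurableSet (parabolicCylinderCentered R c) :=
    (isOpen_parabolicCylinderCentered R c).measurableSet
  -- ### `w` is a distributional solution on the cylinder, bounded by `M`
  have hw2 : ContDiffOn ℝ 2 (uncurry w) (S₀ ×ˢ univ) := hw.smooth_velocity.of_le (by norm_cast)
  have hw1 : ContDiffOn ℝ 1 (uncurry w) (S₀ ×ˢ univ) := hw.smooth_velocity.of_le (by norm_cast)
  have hq1 : ContDiffOn ℝ 1 (uncurry q) (S₀ ×ˢ univ) := hw.smooth_pressure.of_le (by norm_cast)
  have hf0 : ContinuousOn (uncurry (0 : ℝ → EuclideanSpace ℝ (Fin 3) → EuclideanSpace ℝ (Fin 3)))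
      (S₀ ×ˢ univ) := continuousOn_const
  have hdist : IsDistributionalNSSolutionOn (parabolicCylinderCenteredOpens R c) 1 0 w q := by
    refine isDistributionalNSSolutionOn_of_contDiffOn hS₀ hcyl_sub hw2 hq1 hf0 (fun t ht x => ?_)
      hw.divFree
    have hm := hw.momentum t ht x
    rwa [timeDerivWithin_eq_deriv hS₀ ht, ← timeDeriv_apply] at hm
  have hwval : ∀ σ y, w σ y = β • u (s + β * σ) (x₀ + y) := by
    intro σ y
    simp [hw_def, stPull_apply]
  have hbd : ∀ᵐ z ∂(volume.restrict (parabolicCylinderCentered R c)), ‖w z.1 z.2‖ ≤ M := by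
    refine (ae_restrict_iff' hcyl_meas).2 (ae_of_all _ fun z hz => ?_)
    have ht := (htime z.1 (hcyl_time z hz).1 (hcyl_time z hz).2).2
    have hy : x₀ + z.2 ∈ closedBall x₀ r := by
      rw [mem_parabolicCylinderCentered] at hz
      have h1 : dist z.2 (0 : EuclideanSpace ℝ (Fin 3)) < R := hz.2
      rw [mem_closedBall, dist_eq_norm, add_sub_cancel_left]
      rw [dist_zero_right] at h1
      rw [hR_def] at h1
      linarith
    rw [hwval, norm_smul, Real.norm_of_nonneg hβ0.le, hM_def]
    exact mul_le_mul_of_nonneg_left (hslow _ ht _ hy) hβ0.le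
  -- ### the classical gradient as weak spatial gradient, and its dissipation on the cylinder
  set G : ℝ → EuclideanSpace ℝ (Fin 3) → EuclideanSpace ℝ (Fin 3) →L[ℝ] EuclideanSpace ℝ (Fin 3) :=
    fun σ y => fderiv ℝ (w σ) y with hG_def
  have hG : HasWeakSpatialGradientOn (parabolicCylinderCenteredOpens R c) w G :=
    hasWeakSpatialGradientOn_of_contDiffOn hS₀ hcyl_sub hw1
  have hGval : ∀ σ ∈ S₀, ∀ y, G σ y = β • fderiv ℝ (u (s + β * σ)) (x₀ + y) := by
    intro σ hσ y
    have hdiff : Differentiable ℝ (u (s + β * σ)) :=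
      (hclo.contDiff_velocity hσ).differentiable (by simp)
    have h1 : w σ = β • stPull β 1 s x₀ u σ := rfl
    change fderiv ℝ (w σ) y = _
    rw [h1, fderiv_const_smul (differentiable_stPull_slice hdiff y), fderiv_stPull, one_smul,
      one_smul]
  have hGB : ∫⁻ z in parabolicCylinderCentered R c, ENNReal.ofReal (frobeniusNormSq (G z.1 z.2)) ≤ B := by
    -- the integrand is the pull-back of `β² |∇u|²_F`
    set F : ℝ × EuclideanSpace ℝ (Fin 3) → ℝ≥0∞ :=
      fun z => ENNReal.ofReal (β ^ 2 * frobeniusNormSq (fderiv ℝ (u z.1) z.2)) with hF_def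
    have hpre : parabolicCylinderCentered R c ⊆ stAffine β 1 s x₀ ⁻¹' (Ioo 0 T ×ˢ univ) := by
      intro z hz
      exact mk_mem_prod (by simpa [stAffine_apply] using (htime z.1 (hcyl_time z hz).1
        (hcyl_time z hz).2).1) (mem_univ _)
    have heqOn : EqOn (fun z : ℝ × EuclideanSpace ℝ (Fin 3) =>
        ENNReal.ofReal (frobeniusNormSq (G z.1 z.2))) (fun z => F (stAffine β 1 s x₀ z))
        (parabolicCylinderCentered R c) := by
      intro z hz
      have hG1 := hGval z.1 (hcyl_sub hz).1 z.2
      simp only [hF_def, stAffine_fst, stAffine_snd, one_smul, hG1, frobeniusNormSq_const_smul]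
    calc ∫⁻ z in parabolicCylinderCentered R c, ENNReal.ofReal (frobeniusNormSq (G z.1 z.2))
        = ∫⁻ z in parabolicCylinderCentered R c, F (stAffine β 1 s x₀ z) :=
          setLIntegral_congr_fun hcyl_meas heqOn
      _ ≤ ∫⁻ z in stAffine β 1 s x₀ ⁻¹' (Ioo 0 T ×ˢ univ), F (stAffine β 1 s x₀ z) :=
          lintegral_mono_set hpre
      _ = ENNReal.ofReal (β * 1 ^ Module.finrank ℝ (EuclideanSpace ℝ (Fin 3)))⁻¹ *
            ∫⁻ z in Ioo 0 T ×ˢ (univ : Set (EuclideanSpace ℝ (Fin 3))), F z :=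
          setLIntegral_preimage_comp_stAffine hβ0 one_pos s x₀ F _
      _ = ENNReal.ofReal β⁻¹ * ∫⁻ z in Ioo 0 T ×ˢ (univ : Set (EuclideanSpace ℝ (Fin 3))), F z := by
          rw [one_pow, mul_one]
      _ ≤ ENNReal.ofReal β⁻¹ * (ENNReal.ofReal (β ^ 2) * D) := by
          gcongr
          -- Tonelli: the slab integral is at most the iterated one
          have hμ : (volume.restrict (Ioo (0 : ℝ) T ×ˢ (univ : Set (EuclideanSpace ℝ (Fin 3)))) :
              Measure (ℝ × EuclideanSpace ℝ (Fin 3))) =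
              (volume.restrict (Ioo (0 : ℝ) T)).prod
                ((volume : Measure (EuclideanSpace ℝ (Fin 3))).restrict univ) := by
            rw [Measure.prod_restrict, ← Measure.volume_eq_prod]
          rw [hμ]
          calc ∫⁻ z, F z ∂(volume.restrict (Ioo (0 : ℝ) T)).prod
                  ((volume : Measure (EuclideanSpace ℝ (Fin 3))).restrict univ)
              ≤ ∫⁻ τ in Ioo (0 : ℝ) T, ∫⁻ x in univ, F (τ, x) := lintegral_prod_le _
            _ = ∫⁻ τ in Ioo (0 : ℝ) T, ∫⁻ x, ENNReal.ofReal (β ^ 2) *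
                  ENNReal.ofReal (frobeniusNormSq (fderiv ℝ (u τ) x)) := by
                simp only [Measure.restrict_univ, hF_def]
                refine lintegral_congr fun τ => lintegral_congr fun x => ?_
                exact ENNReal.ofReal_mul (sq_nonneg β)
            _ = ENNReal.ofReal (β ^ 2) * D := by
                rw [hD_def, ← lintegral_const_mul' _ _ ENNReal.ofReal_ne_top]
                refine lintegral_congr fun τ => ?_
                rw [lintegral_const_mul' _ _ ENNReal.ofReal_ne_top]
      _ = (B : ℝ≥0∞) := by
          rw [hB_def, ENNReal.coe_toNNReal hBtop, ← mul_assoc,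
            ← ENNReal.ofReal_mul (inv_nonneg.2 hβ0.le)]
          congr 2
          rw [pow_two, inv_mul_cancel_left₀ hβ0.ne']
  -- ### Serrin's spin bound up to the top, on the inner cylinder
  have hspin := hK w q G hdist hbd hG hGB
  set A : Set (ℝ × EuclideanSpace ℝ (Fin 3)) :=
    Ioo (-R ^ 2 - ρ ^ 2) 0 ×ˢ ball (0 : EuclideanSpace ℝ (Fin 3)) ρ with hA_def
  have hA : IsOpen A := isOpen_Ioo.prod isOpen_ball
  have hρR2 : ρ ^ 2 < R ^ 2 := pow_lt_pow_left₀ hρR hρ0.le two_ne_zero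
  have hAtime : ∀ σ ∈ Icc (-R ^ 2 - ρ ^ 2) (0 : ℝ), -(2 * R ^ 2) ≤ σ ∧ σ ≤ 0 := by
    intro σ hσ
    constructor <;> linarith [hσ.1, hσ.2]
  have hlt0 : -R ^ 2 - ρ ^ 2 ≠ (0 : ℝ) := by
    have : -R ^ 2 - ρ ^ 2 < (0 : ℝ) := by nlinarith
    exact this.ne
  have hclA_eq : closure A = Icc (-R ^ 2 - ρ ^ 2) 0 ×ˢ closedBall (0 : EuclideanSpace ℝ (Fin 3)) ρ := by
    rw [hA_def, closure_prod_eq, closure_Ioo hlt0, closure_ball _ hρ0.ne']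
  have hclA : closure A ⊆ S₀ ×ˢ (univ : Set (EuclideanSpace ℝ (Fin 3))) := by
    rw [hclA_eq]
    intro z hz
    exact mk_mem_prod (hmemS₀ z.1 (hAtime z.1 hz.1).1 (hAtime z.1 hz.1).2) (mem_univ _)
  have h0A : ((0 : ℝ), (0 : EuclideanSpace ℝ (Fin 3))) ∈ closure A := by
    rw [hclA_eq]
    refine mk_mem_prod ⟨?_, le_rfl⟩ (mem_closedBall_self hρ0.le)
    nlinarith
  -- continuity of the gradient of `w` on `S₀ × ℝ³`
  have hGcont : ContinuousOn (fun z : ℝ × EuclideanSpace ℝ (Fin 3) => G z.1 z.2) (S₀ ×ˢ univ) :=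
    continuousOn_fderiv_slice_of_contDiffOn hw1 hS₀.uniqueDiffOn
  have hcoord : ∀ i : Fin 3, Continuous fun v : EuclideanSpace ℝ (Fin 3) => v i := fun i =>
    (EuclideanSpace.proj (𝕜 := ℝ) i).continuous
  -- the spin entries at the top centre `(0, 0)`
  have htop : ∀ i j : Fin 3, |G 0 0 (EuclideanSpace.single j 1) i -
      G 0 0 (EuclideanSpace.single i 1) j| ≤ K := by
    intro i j
    set f : ℝ × EuclideanSpace ℝ (Fin 3) → ℝ := fun z =>
      |G z.1 z.2 (EuclideanSpace.single j 1) i - G z.1 z.2 (EuclideanSpace.single i 1) j| with hf_def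
    have hfcont : ContinuousOn f (S₀ ×ˢ univ) := by
      have h1 : ContinuousOn (fun z : ℝ × EuclideanSpace ℝ (Fin 3) =>
          G z.1 z.2 (EuclideanSpace.single j 1) i) (S₀ ×ˢ univ) :=
        (hcoord i).comp_continuousOn (hGcont.clm_apply continuousOn_const)
      have h2 : ContinuousOn (fun z : ℝ × EuclideanSpace ℝ (Fin 3) =>
          G z.1 z.2 (EuclideanSpace.single i 1) j) (S₀ ×ˢ univ) :=
        (hcoord j).comp_continuousOn (hGcont.clm_apply continuousOn_const)
      exact continuous_abs.comp_continuousOn (h1.sub h2)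
    have hae : ∀ᵐ z ∂(volume.restrict A), f z ≤ K := hspin.mono fun z hz => hz i j
    have hA' : ∀ z ∈ A, f z ≤ K :=
      forall_le_of_ae_restrict_le hA (hfcont.mono (subset_closure.trans hclA)) hae
    have key : f ((0 : ℝ), (0 : EuclideanSpace ℝ (Fin 3))) ≤ K :=
      le_on_closure (f := f) (g := fun _ : ℝ × EuclideanSpace ℝ (Fin 3) => K) hA'
        (hfcont.mono hclA) continuousOn_const h0A
    simpa only [hf_def] using key
  -- ### back to `u`: `G(0, 0) = ν⁻¹ ∇u(s, x₀)`
  have h0S : (0 : ℝ) ∈ S₀ := hmemS₀ 0 (by nlinarith) le_rfl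
  have hG0 : G 0 0 = β • fderiv ℝ (u s) x₀ := by
    have := hGval 0 h0S 0
    simpa using this
  have hentries : ∀ i j : Fin 3, |fderiv ℝ (u s) x₀ (EuclideanSpace.single j 1) i -
      fderiv ℝ (u s) x₀ (EuclideanSpace.single i 1) j| ≤ ν * K := by
    intro i j
    have h := htop i j
    rw [hG0] at h
    simp only [_root_.smul_apply, PiLp.smul_apply, smul_eq_mul] at h
    rw [← mul_sub, abs_mul, abs_of_pos hβ0] at h
    have hνβ : ν * β = 1 := by rw [hβ_def, mul_inv_cancel₀ hν.ne']
    calc |fderiv ℝ (u s) x₀ (EuclideanSpace.single j 1) i -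
          fderiv ℝ (u s) x₀ (EuclideanSpace.single i 1) j|
        = ν * (β * |fderiv ℝ (u s) x₀ (EuclideanSpace.single j 1) i -
          fderiv ℝ (u s) x₀ (EuclideanSpace.single i 1) j|) := by
          rw [← mul_assoc, hνβ, one_mul]
      _ ≤ ν * K := mul_le_mul_of_nonneg_left h hν.le
  -- ### the curl
  exact norm_le_two_mul_of_abs_apply_le (by positivity) (abs_curl_apply_le_of_spin hentries)

end Summit.NavierStokesRegularity.NavierStokesRegularity.Theorems.SlowClassProduction.Birth

end
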